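import Summits.QuantumFields.YangMills.Theorems.BalabanUVNodesN13Cor3PinsMargDensityVersionAtRecord13
import Literature.MathematicalPhysics.QuantumFieldTheory.Balaban1983to89.T4TreeGaugeHolonomyLaw

/-!
# BalabanUVNodes ∕ N13 — LOCATED KERNEL CERTIFICATE (converse half of p610399): THE MARGINAL-DENSITY VERSION OF RECORD IS NOT DETERMINED AT ANY
# POINT BY ITS SPECIFICATION — both values at `V₁` occur among `dV`-a.e.-equal versions; so the point value that [III] Cor. 3 (2.50) ∕ K1⁷'s (B) AS TYPED
# pins (dag-n13-w1, `…N13Cor3PinsMargDensityVersionAtRecord13`) is invisible to every hypothesis on the version that is invariant under `dV`-null modification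

Cell `pub-ymgap` (HUMAN RULING D-0062 Track A ∕ D-0149 width), WIDTH SEAT `pub-ymgap-dag-n13-w2` (gen 4, CLAIM-1, INBOX l.31814), keys K1⁸ `StabilityBRunRowsAtRecordR13SepCoPH` =
stmt-QuantumFields-26907 (route rev 27, the deciding crux; K1⁷ `StabilityBAtRecordR13SepCoPH` = stmt-QuantumFields-20542 now `aside`, same (B) conjunct) (`--kind proof --supports … --as
helper`; count-neutral; LOCATED reading for plan ∕ CRIT-1 ∕ dag-lead's `RECORD13-CLOSABILITY-GATE.md` — NO re-cut
asked by this seat).  [III] = [Balaban1988Convergent], [B16] = [Balaban1989LargeFieldII], [I] = [Balaban1987RG1].  SIBLING of dag-n13-w1 g4's p610399 (cited BY NAME, nothing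
restated): that file proves the FORWARD half — the lower inequality of (2.50) ∕ [B16] (0.1) at level `k+1 ≥ 1` of NODE 00's Stage-13 record, AS TYPED (at every field `V`), and
hence K1⁷'s (B) conjunct and the crux decl itself, PIN the point value `avgDensity (avOfRecord F 2 P.K k).avg V₁ ≠ 0` of the marginal-density VERSION OF RECORD
(`T4AveragingDisintegration.margDensity = T4TermReprCoupling.rnNN …`, i.e. `(Measure.rnDeriv ((dU_k).map Ū) dV_{k+1} ·).toNNReal`, Mathlib's `Classical.choose` of the
Lebesgue decomposition) at `V₁ := critCfgOfRecord θ.ν P.K (k+1) 1`.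

WHAT THIS FILE PROVES (theorems only; 0 `def`; no `instance`, no `notation`; standard axioms).
§1 [folklore] GENERIC, over any measurable space with measurable singletons and a point `y` with `μ {y} = 0`: modifying a function at `y` is a `μ`-a.e. modification
   (`piecewise_singleton_ae_eq`), keeps measurability (`measurable_piecewise_singleton`) and the `withDensity` measure (`withDensity_piecewise_singleton`); hence
   ★ `exists_version_apply_eq` — a marginal-density VERSION `h` (measurable, `μ.withDensity ↑h = ρ`) can be given ANY prescribed value at `y` and stays a version `=ᵐ[μ] h`;
   ★ `exists_lebesgueDecomposition_apply_eq` — the ∃-body of Mathlib's `Measure.HaveLebesgueDecomposition ρ μ` (the specification `Measure.rnDeriv ρ μ` is `Classical.choose` of)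
   has witnesses whose density takes ANY prescribed value at `y`; ★ `exists_of_aeInvariant` — every `=ᵐ[μ]`-invariant predicate holding at `h` holds at functions with any
   value at `y`; `aeInvariant_withDensity_eq` ∕ `aeInvariant_of_withDensity` — the defining law-level identity, and every property factoring through the measure
   `μ.withDensity ↑·`, IS such a predicate; `mul_ae_eq_mul_of_ae_eq` (bookkeeping for the 𝐓-image formula).
§2 [folklore] `fieldMeasure_singleton_SU2` — product Haar measure on `GaugeField P j (SU 2)` charges no configuration (`T4TreeGaugeHolonomyLaw.measure_singleton_haar_SU2` on one
   bond + `Measure.pi_eval_preimage_null`).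
§3 AT THE RECORD (`N = 2`, `k < K`, ANY coarse field `V₁`): `avgDensity_avOfRecord_isVersion` (the version of record IS a version: `withDensity_margDensity` ∘ `avOfRecord_haarAC`);
   ★★ `exists_version_ae_eq_avgDensity_apply_eq` (for every `c : ℝ≥0` a version `=ᵐ[dV]` the version of record with value `c` at `V₁`; `c = 0`: `…_eq_zero`, `c = 1`: `…_eq_one`);
   ★★ `exists_lebesgueDecomposition_witness_avOfRecord_apply_eq` (the ∃-statement BEHIND `avgDensity (avOfRecord F 2 K k).avg` — `avgDensity_avOfRecord_eq_choose`: the version of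
   record is LITERALLY `(Classical.choose ‹that ∃›).2 ·|>.toNNReal` — has witnesses with density value `0` at `V₁` and witnesses with value `1` at `V₁`);
   ★★★ `exists_aeInvariant_holds_apply_eq_avOfRecord` ∕ `not_forall_aeInvariant_apply_ne_zero` (NO `dV`-a.e.-invariant hypothesis `Φ` satisfied by the version of record forces
   `· V₁ ≠ 0` — or `· V₁ = 0`).
§3b ★★ `exists_tImage_of_version_ae_eq_tdens_apply_eq_zero` — def-T's 𝐓-image of record is `avgDensity · bracket` (dag-n13-w1's `tdensOfRecord₁₃_eq_avgDensity_mul_sum`, p607786 §5,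
   BY NAME); the SAME formula on the vanishing version `h₀` of §3 is a density `ρ′ =ᵐ[dV] 𝐓ρ_k` (every law-level property of the 𝐓-image is shared) with `ρ′(V₁) = 0` — at any
   `θ : Stage13Params F 2`, any selector, `k < K`, any `V₁`.
§4 JUNCTION WITH p610399, BY NAME: ★★★ `pin_and_nonDetermination_of_cor3With_datum` ((2.50) at the datum pins `avgDensity … V₁ ≠ 0` — dag-n13-w1's
   `avgDensity_critCfg_one_ne_zero_of_cor3With_datum` — AND a version `=ᵐ[dV]` it vanishes at `V₁`) and ★★★ `pin_and_nonDetermination_of_stabilityBAtRecordR13SepCoPH` (the same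
   from the crux decl via `exists_avgDensity_ne_zero_of_stabilityBAtRecordR13SepCoPH`, for every family carrying K0⁷'s conclusion) and ★★★
   `pin_and_nonDetermination_of_stabilityBRunRowsAtRecordR13SepCoPH` (the same from the rev-26∕27 DECIDING crux K1⁸ `StabilityBRunRowsAtRecordR13SepCoPH` = stmt-QuantumFields-26907,
   whose (B) ∧ window conjuncts are K1⁷'s verbatim).

READING (prose; a kernel theorem cannot state provability).  Everything the tree knows — or CAN know through Mathlib — about the version of record is a consequence of the
specification `Measurable ∧ singularPart ⟂ dV ∧ (dU).map Ū = singularPart + dV.withDensity ·` (`Measure.haveLebesgueDecomposition_spec`), and every law-level fact about it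
(`withDensity_margDensity`, `disintegration_fieldMeasure`, the `IsRT`∕fibre-a.e. identities, integrals against it) is invariant under `dV`-null modification; §3 shows that such
facts are shared by versions with `· V₁ = 0` and by versions with `· V₁ ≠ 0`.  So the point value pinned by (2.50)-as-typed at level ≥ 1 (p610399) is decided by WHICH witness
`Classical.choice` returns, not by Bałaban's estimates: the (B)-face of K1⁷ at levels ≥ 1, as typed on `densOfRecord₁₃`, is reachable only in a version-free currency
(`dV`-a.e. ∕ as an inequality of measures ∕ integrated — dag-n13-w1's sockets p613095, the rung's (G2)∕(G5) reading) or after re-pointing `avgDensity` to a canonical version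
(as NODE 00 did for β's transport, `TcanOfRecord`, gate row P7∕F7).  LOCATED; count-neutral; the planners decide what, if anything, follows.

HONEST FRAMING.  Count-neutral kernel measure theory (null-set modification of a density; product-Haar singletons on `SU(2)`) + by-name composition with p610399; nothing of
Bałaban's asserted or refuted; K1⁷ NEITHER proved NOR refuted; N13 NOT discharged; no stub closed; counts unmoved (typed 28∕28 · discharged 5∕27 · A 5∕28); one finite
`𝕋⁴_{L^K}` programme at fixed `ε = L^{−K}`, Bałaban AS PRINTED; route R4 closes the CONDITIONAL finite-𝕋⁴ rung `BalabanLadder.UV` only — the Yang–Mills mass gap (Clay) is NOT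
proved by any of this; nothing continuum ∕ ℝ⁴ ∕ OS.  No `sorry`.
-/

noncomputable section

open scoped ENNReal NNReal

namespace Summit.QuantumFields.YangMills.BalabanUVNodes.N13Cor3MargDensityVersionNotDeterminedAtRecord13

open MeasureTheory
open Literature.MathematicalPhysics.QuantumFieldTheory.Balaban1983to89
open Literature.MathematicalPhysics.QuantumFieldTheory.Balaban1983to89.T4Continuum (T4Family)
open Literature.MathematicalPhysics.QuantumFieldTheory.Balaban1983to89.Node00
open T4AveragingDisintegration (avgDensity avgKernel margDensity jointLaw measurable_margDensity withDensity_margDensity)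
open Summit.QuantumFields.YangMills.BalabanUVNodes.N13UVRowRFreeAtLiveSelectorRecord13 (tdensOfRecord₁₃_eq_avgDensity_mul_sum)
open T4TreeGaugeHolonomyLaw (measure_singleton_haar_SU2)
open Summit.QuantumFields.YangMills.BalabanUVNodes.N13Cor3PinsMargDensityVersionAtRecord13
  (avgDensity_critCfg_one_ne_zero_of_cor3With_datum exists_avgDensity_ne_zero_of_endStatementBPrinted_of_window
    exists_avgDensity_ne_zero_of_stabilityBAtRecordR13SepCoPH)

/-! ## §1 GENERIC: modification at a null point — versions, the Lebesgue-decomposition specification, a.e.-invariant predicates -/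

section Generic

variable {α : Type*} [MeasurableSpace α] {μ : Measure α} {y : α}

open Classical in
/-- **Modifying a function at a `μ`-null point is a `μ`-a.e. modification.** [folklore] -/
theorem piecewise_singleton_ae_eq (hy : μ {y} = 0) {β : Type*} (f g : α → β) : ({y} : Set α).piecewise g f =ᵐ[μ] f := by
  filter_upwards [measure_eq_zero_iff_ae_notMem.1 hy] with x hx
  exact Set.piecewise_eq_of_notMem _ _ _ hx

open Classical in
/-- … and keeps measurability (singletons are measurable). [folklore] -/
theorem measurable_piecewise_singleton [MeasurableSingletonClass α] {β : Type*} [MeasurableSpace β] {f g : α → β} (hf : Measurable f) (hg : Measurable g) :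
    Measurable (({y} : Set α).piecewise g f) :=
  Measurable.piecewise (measurableSet_singleton y) hg hf

open Classical in
/-- **`withDensity` does not see a modification at a null point.** [folklore] -/
theorem withDensity_piecewise_singleton (hy : μ {y} = 0) (f g : α → ℝ≥0∞) : μ.withDensity (({y} : Set α).piecewise g f) = μ.withDensity f :=
  withDensity_congr_ae (piecewise_singleton_ae_eq hy f g)

open Classical in
/-- **★ A MARGINAL-DENSITY VERSION CAN BE GIVEN ANY VALUE AT A NULL POINT**: if `h` is a version — measurable with `μ.withDensity ↑h = ρ` — then for every `c` there is a version
`h′ =ᵐ[μ] h` with `h′ y = c`. [folklore] -/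
theorem exists_version_apply_eq [MeasurableSingletonClass α] (hy : μ {y} = 0) {ρ : Measure α} {h : α → ℝ≥0} (hm : Measurable h) (hρ : μ.withDensity (fun x => (h x : ℝ≥0∞)) = ρ) (c : ℝ≥0) :
    ∃ h' : α → ℝ≥0, Measurable h' ∧ μ.withDensity (fun x => (h' x : ℝ≥0∞)) = ρ ∧ h' =ᵐ[μ] h ∧ h' y = c := by
  refine ⟨({y} : Set α).piecewise (fun _ => c) h, measurable_piecewise_singleton hm measurable_const, ?_, piecewise_singleton_ae_eq hy h _, ?_⟩
  · rw [← hρ]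
    refine withDensity_congr_ae ?_
    filter_upwards [piecewise_singleton_ae_eq hy h fun _ => c] with x hx
    rw [hx]
  · exact Set.piecewise_eq_of_mem _ _ _ (Set.mem_singleton y)

open Classical in
/-- **★ THE LEBESGUE-DECOMPOSITION SPECIFICATION DOES NOT DETERMINE THE DENSITY AT A NULL POINT**: the ∃-body of Mathlib's `Measure.HaveLebesgueDecomposition ρ μ` — `∃ p, Measurable p.2 ∧
p.1 ⟂ₘ μ ∧ ρ = p.1 + μ.withDensity p.2`, the statement `Measure.rnDeriv ρ μ` is `Classical.choose` of — has, for EVERY `c`, a witness with `p.2 y = c`. [folklore] -/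
theorem exists_lebesgueDecomposition_apply_eq [MeasurableSingletonClass α] (hy : μ {y} = 0) (ρ : Measure α) [ρ.HaveLebesgueDecomposition μ] (c : ℝ≥0∞) :
    ∃ p : Measure α × (α → ℝ≥0∞), Measurable p.2 ∧ p.1 ⟂ₘ μ ∧ ρ = p.1 + μ.withDensity p.2 ∧ p.2 y = c := by
  obtain ⟨hmeas, hsing, hdec⟩ := Measure.haveLebesgueDecomposition_spec ρ μ
  refine ⟨(ρ.singularPart μ, ({y} : Set α).piecewise (fun _ => c) (ρ.rnDeriv μ)), measurable_piecewise_singleton hmeas measurable_const, hsing, ?_, ?_⟩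
  · rw [withDensity_piecewise_singleton hy]
    exact hdec
  · show ({y} : Set α).piecewise (fun _ => c) (ρ.rnDeriv μ) y = c
    exact Set.piecewise_eq_of_mem _ _ _ (Set.mem_singleton y)

open Classical in
/-- **★ NO `μ`-A.E.-INVARIANT PREDICATE DETERMINES A VALUE AT A NULL POINT**: if `Φ` is invariant under `=ᵐ[μ]` and holds at `h`, then for every `c` it holds at some `h′ =ᵐ[μ] h`
with `h′ y = c`. [folklore] -/
theorem exists_of_aeInvariant (hy : μ {y} = 0) {β : Type*} (Φ : (α → β) → Prop) (hΦ : ∀ f g : α → β, f =ᵐ[μ] g → Φ f → Φ g) {h : α → β} (hh : Φ h) (c : β) :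
    ∃ h' : α → β, Φ h' ∧ h' =ᵐ[μ] h ∧ h' y = c :=
  ⟨({y} : Set α).piecewise (fun _ => c) h, hΦ _ _ (piecewise_singleton_ae_eq hy h fun _ => c).symm hh, piecewise_singleton_ae_eq hy h _,
    Set.piecewise_eq_of_mem _ _ _ (Set.mem_singleton y)⟩

/-- The defining law-level identity of a version, `μ.withDensity ↑· = ρ`, IS a `μ`-a.e.-invariant predicate. [folklore] -/
theorem aeInvariant_withDensity_eq (ρ : Measure α) (f g : α → ℝ≥0) (hfg : f =ᵐ[μ] g) (hf : μ.withDensity (fun x => (f x : ℝ≥0∞)) = ρ) :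
    μ.withDensity (fun x => (g x : ℝ≥0∞)) = ρ := by
  rw [← hf]
  refine withDensity_congr_ae ?_
  filter_upwards [hfg] with x hx
  rw [hx]

/-- **Every property of a version that FACTORS THROUGH THE MEASURE IT DEFINES is a.e.-invariant** (`Ψ (μ.withDensity ↑·)` for any `Ψ : Measure α → Prop` — e.g. the
disintegration identity `(μ.withDensity ↑h) ⊗ₘ κ = jointLaw`, push-forward ∕ `IsRT` identities, integrals against `h·dμ`). [folklore] -/
theorem aeInvariant_of_withDensity (Ψ : Measure α → Prop) (f g : α → ℝ≥0) (hfg : f =ᵐ[μ] g) (hf : Ψ (μ.withDensity fun x => (f x : ℝ≥0∞))) :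
    Ψ (μ.withDensity fun x => (g x : ℝ≥0∞)) := by
  have e : (μ.withDensity fun x => (f x : ℝ≥0∞)) = μ.withDensity fun x => (g x : ℝ≥0∞) := by
    refine withDensity_congr_ae ?_
    filter_upwards [hfg] with x hx
    rw [hx]
  rwa [e] at hf

/-- A pointwise product with a fixed factor respects `=ᵐ[μ]` (used for the 𝐓-image formula `version · bracket`). [folklore] -/
theorem mul_ae_eq_mul_of_ae_eq {f g : α → ℝ≥0} (hfg : f =ᵐ[μ] g) (I : α → ℝ) : (fun x => (f x : ℝ) * I x) =ᵐ[μ] fun x => (g x : ℝ) * I x := by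
  filter_upwards [hfg] with x hx
  rw [hx]

end Generic

/-! ## §2 PRODUCT HAAR MEASURE ON `SU(2)`-FIELDS CHARGES NO CONFIGURATION -/

section Haar

/-- **`dV {V} = 0` on `GaugeField P j (SU 2)`**: the lattice has a positive bond `b₀` (`P.hd`), `{V} ⊆ {W | W b₀ = V b₀}`, and the `b₀`-marginal of product Haar measure is Haar on
`SU(2)`, which charges no point (`T4TreeGaugeHolonomyLaw.measure_singleton_haar_SU2`). [folklore] -/
theorem fieldMeasure_singleton_SU2 {P : Params} {j : ℕ} (V : GaugeField P j (SU 2)) : fieldMeasure P j (SU 2) {V} = 0 := by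
  obtain ⟨b₀⟩ : Nonempty (PBond P j) := ⟨⟨default, ⟨0, P.hd⟩⟩⟩
  have hsub : ({V} : Set (GaugeField P j (SU 2))) ⊆ Function.eval b₀ ⁻¹' {V b₀} := by
    intro W hW
    rw [Set.mem_singleton_iff.mp hW]
    rfl
  refine measure_mono_null hsub ?_
  rw [fieldMeasure]
  exact Measure.pi_eval_preimage_null _ (measure_singleton_haar_SU2 (V b₀))

end Haar

/-! ## §3 AT THE RECORD (`N = 2`): versions of the marginal density of Bałaban's block averaging with EITHER value at any coarse field -/

section Record

variable (F : T4Family)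

/-- **The version of record IS a version**: `avgDensity (avOfRecord F N K k).avg` is measurable and `dV_{k+1}.withDensity ↑(avgDensity) = (dU_k).map Ū` in the standing range
`k < K` (`withDensity_margDensity` with `avOfRecord_measurable` ∕ `avOfRecord_haarAC`).  Any `N ≥ 1`. [cite: Balaban1987RG1, (0.4) p.253 (kernel property of the tree's averaging, by name)] -/
theorem avgDensity_avOfRecord_isVersion (N : ℕ) [NeZero N] (K k : ℕ) (hk : k < K) :
    Measurable (avgDensity (avOfRecord F N K k).avg) ∧
      (fieldMeasure (F.P K) (k + 1) (SU N)).withDensity (fun V => (avgDensity (avOfRecord F N K k).avg V : ℝ≥0∞)) =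
        (fieldMeasure (F.P K) k (SU N)).map (avOfRecord F N K k).avg :=
  ⟨measurable_margDensity, withDensity_margDensity _ _ (avOfRecord_measurable F N K k) (avOfRecord_haarAC F N K k hk)⟩

/-- **★★ FOR EVERY `c`, A VERSION `=ᵐ[dV]` THE VERSION OF RECORD WITH VALUE `c` AT `V₁`** (`N = 2`, `k < K`, any coarse field `V₁`). [cite: Balaban1987RG1, (0.4) p.253 (bookkeeping over the tree's averaging); Balaban1988Convergent, (3.1) p.264] -/
theorem exists_version_ae_eq_avgDensity_apply_eq (K k : ℕ) (hk : k < K) (V₁ : GaugeField (F.P K) (k + 1) (SU 2)) (c : ℝ≥0) :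
    ∃ h : GaugeField (F.P K) (k + 1) (SU 2) → ℝ≥0, Measurable h ∧
      (fieldMeasure (F.P K) (k + 1) (SU 2)).withDensity (fun V => (h V : ℝ≥0∞)) = (fieldMeasure (F.P K) k (SU 2)).map (avOfRecord F 2 K k).avg ∧
      h =ᵐ[fieldMeasure (F.P K) (k + 1) (SU 2)] avgDensity (avOfRecord F 2 K k).avg ∧ h V₁ = c :=
  exists_version_apply_eq (fieldMeasure_singleton_SU2 V₁) measurable_margDensity (avgDensity_avOfRecord_isVersion F 2 K k hk).2 c

/-- **A version `=ᵐ[dV]` the version of record VANISHING at `V₁`.** [cite: Balaban1987RG1, (0.4) p.253 (bookkeeping)] -/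
theorem exists_version_ae_eq_avgDensity_eq_zero (K k : ℕ) (hk : k < K) (V₁ : GaugeField (F.P K) (k + 1) (SU 2)) :
    ∃ h : GaugeField (F.P K) (k + 1) (SU 2) → ℝ≥0, Measurable h ∧
      (fieldMeasure (F.P K) (k + 1) (SU 2)).withDensity (fun V => (h V : ℝ≥0∞)) = (fieldMeasure (F.P K) k (SU 2)).map (avOfRecord F 2 K k).avg ∧
      h =ᵐ[fieldMeasure (F.P K) (k + 1) (SU 2)] avgDensity (avOfRecord F 2 K k).avg ∧ h V₁ = 0 :=
  exists_version_ae_eq_avgDensity_apply_eq F K k hk V₁ 0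

/-- **A version `=ᵐ[dV]` the version of record with value `1` (in particular `≠ 0`) at `V₁`.** [cite: Balaban1987RG1, (0.4) p.253 (bookkeeping)] -/
theorem exists_version_ae_eq_avgDensity_eq_one (K k : ℕ) (hk : k < K) (V₁ : GaugeField (F.P K) (k + 1) (SU 2)) :
    ∃ h : GaugeField (F.P K) (k + 1) (SU 2) → ℝ≥0, Measurable h ∧
      (fieldMeasure (F.P K) (k + 1) (SU 2)).withDensity (fun V => (h V : ℝ≥0∞)) = (fieldMeasure (F.P K) k (SU 2)).map (avOfRecord F 2 K k).avg ∧
      h =ᵐ[fieldMeasure (F.P K) (k + 1) (SU 2)] avgDensity (avOfRecord F 2 K k).avg ∧ h V₁ ≠ 0 := by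
  obtain ⟨h, hm, hρ, hae, h1⟩ := exists_version_ae_eq_avgDensity_apply_eq F K k hk V₁ 1
  exact ⟨h, hm, hρ, hae, by rw [h1]; exact one_ne_zero⟩

/-- **THE VERSION OF RECORD IS LITERALLY `Classical.choose` OF THE LEBESGUE-DECOMPOSITION SPECIFICATION** (unfolding `avgDensity = margDensity = rnNN`, `Measure.rnDeriv_def`):
`avgDensity (avOfRecord F N K k).avg V = ((Classical.choose h.lebesgue_decomposition).2 V).toNNReal` for the instance `h : HaveLebesgueDecomposition ((jointLaw dU Ū).fst) dV`.
Any `N`. [folklore] -/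
theorem avgDensity_avOfRecord_eq_choose (N : ℕ) [NeZero N] (K k : ℕ)
    [h : ((jointLaw (fieldMeasure (F.P K) k (SU N)) (avOfRecord F N K k).avg).fst).HaveLebesgueDecomposition (fieldMeasure (F.P K) (k + 1) (SU N))]
    (V : GaugeField (F.P K) (k + 1) (SU N)) :
    avgDensity (avOfRecord F N K k).avg V = ((Classical.choose h.lebesgue_decomposition).2 V).toNNReal := by
  show ((((jointLaw (fieldMeasure (F.P K) k (SU N)) (avOfRecord F N K k).avg).fst).rnDeriv (fieldMeasure (F.P K) (k + 1) (SU N))) V).toNNReal = _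
  rw [Measure.rnDeriv_def, dif_pos h]

/-- **★★ THE ∃-STATEMENT BEHIND THE VERSION OF RECORD HAS WITNESSES WITH EVERY PRESCRIBED DENSITY VALUE AT `V₁`** (`N = 2`): for every `c : ℝ≥0∞` a Lebesgue decomposition
`((dU_k).map Ū restricted as jointLaw.fst) = s + dV_{k+1}.withDensity f` with `f` measurable, `s ⟂ dV`, and `f V₁ = c`.  With `c = 0` and `c = 1`: the specification admits
BOTH a vanishing and a non-vanishing density value at `V₁`. [folklore] -/
theorem exists_lebesgueDecomposition_witness_avOfRecord_apply_eq (K k : ℕ) (V₁ : GaugeField (F.P K) (k + 1) (SU 2)) (c : ℝ≥0∞) :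
    ∃ p : Measure (GaugeField (F.P K) (k + 1) (SU 2)) × (GaugeField (F.P K) (k + 1) (SU 2) → ℝ≥0∞),
      Measurable p.2 ∧ p.1 ⟂ₘ fieldMeasure (F.P K) (k + 1) (SU 2) ∧
        (jointLaw (fieldMeasure (F.P K) k (SU 2)) (avOfRecord F 2 K k).avg).fst = p.1 + (fieldMeasure (F.P K) (k + 1) (SU 2)).withDensity p.2 ∧ p.2 V₁ = c :=
  exists_lebesgueDecomposition_apply_eq (fieldMeasure_singleton_SU2 V₁) _ c

/-- **★★★ NO `dV`-A.E.-INVARIANT HYPOTHESIS ON THE VERSION OF RECORD FORCES A VALUE AT `V₁`**: every predicate `Φ` invariant under `=ᵐ[dV_{k+1}]` and satisfied by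
`avgDensity (avOfRecord F 2 K k).avg` is also satisfied by some `h =ᵐ[dV]` it with `h V₁ = c`, for EVERY `c`. [folklore] -/
theorem exists_aeInvariant_holds_apply_eq_avOfRecord (K k : ℕ) (V₁ : GaugeField (F.P K) (k + 1) (SU 2))
    (Φ : (GaugeField (F.P K) (k + 1) (SU 2) → ℝ≥0) → Prop) (hΦ : ∀ f g, f =ᵐ[fieldMeasure (F.P K) (k + 1) (SU 2)] g → Φ f → Φ g)
    (hrec : Φ (avgDensity (avOfRecord F 2 K k).avg)) (c : ℝ≥0) :
    ∃ h : GaugeField (F.P K) (k + 1) (SU 2) → ℝ≥0, Φ h ∧ h =ᵐ[fieldMeasure (F.P K) (k + 1) (SU 2)] avgDensity (avOfRecord F 2 K k).avg ∧ h V₁ = c :=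
  exists_of_aeInvariant (fieldMeasure_singleton_SU2 V₁) Φ hΦ hrec c

/-- **… so no such hypothesis implies `· V₁ ≠ 0` for all its models, and none implies `· V₁ = 0`.** [folklore] -/
theorem not_forall_aeInvariant_apply_ne_zero (K k : ℕ) (V₁ : GaugeField (F.P K) (k + 1) (SU 2))
    (Φ : (GaugeField (F.P K) (k + 1) (SU 2) → ℝ≥0) → Prop) (hΦ : ∀ f g, f =ᵐ[fieldMeasure (F.P K) (k + 1) (SU 2)] g → Φ f → Φ g)
    (hrec : Φ (avgDensity (avOfRecord F 2 K k).avg)) :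
    ¬ (∀ h, Φ h → h V₁ ≠ 0) ∧ ¬ (∀ h, Φ h → h V₁ = 0) := by
  obtain ⟨h₀, hΦ₀, -, h00⟩ := exists_aeInvariant_holds_apply_eq_avOfRecord F K k V₁ Φ hΦ hrec 0
  obtain ⟨h₁, hΦ₁, -, h11⟩ := exists_aeInvariant_holds_apply_eq_avOfRecord F K k V₁ Φ hΦ hrec 1
  exact ⟨fun H => H h₀ hΦ₀ h00, fun H => one_ne_zero (h11.symm.trans (H h₁ hΦ₁))⟩

end Record

/-! ## §3b THE 𝐓-IMAGE FORMULA ON AN EQUALLY VALID VERSION: a density `=ᵐ[dV]` the 𝐓-image of record, of the SAME form `version · bracket`, VANISHING at `V₁` -/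

section TImage

variable (F : T4Family) (θ : Stage13Params F 2)

/-- **★★ AN A.E.-EQUAL 𝐓-IMAGE BUILT FROM AN EQUALLY VALID VERSION VANISHES AT `V₁`.**  def-T's 𝐓-image of record is `𝐓ρ_k(V′) = avgDensity(V′) · bracket(V′)` (dag-n13-w1's
`tdensOfRecord₁₃_eq_avgDensity_mul_sum`, p607786 §5, BY NAME).  Replacing the version of record by the version `h₀` of §3 (same measurability, same defining identity
`dV.withDensity ↑h₀ = (dU).map Ū`, `h₀ =ᵐ[dV] avgDensity`) gives a density `ρ′ = h₀ · bracket` which is `dV`-a.e. EQUAL to `𝐓ρ_k` — hence has every law-level property of it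
(same integrals, same `IsRT`∕push-forward identities) — and VANISHES at `V₁`; so wherever `χ_{k+1}(V₁)·exp(…) > 0` the lower inequality of (2.50) FAILS for `ρ′` at `V₁`
while holding or failing for `𝐓ρ_k` according to the choice of version alone.  Any `θ : Stage13Params F 2`, any selector; `k < K`.
[cite: Balaban1988Convergent, (3.1) p.264, (3.24)–(3.25) p.270, Cor. 3 (2.50) p.264; Balaban1987RG1, (0.4) p.253 (bookkeeping over def-T's definition)] -/
theorem exists_tImage_of_version_ae_eq_tdens_apply_eq_zero (P : B12.RunParams) (k : ℕ) (hk : k < P.K) (V₁ : GaugeField (F.P P.K) (k + 1) (SU 2)) :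
    ∃ (h₀ : GaugeField (F.P P.K) (k + 1) (SU 2) → ℝ≥0) (ρ' : GaugeField (F.P P.K) (k + 1) (SU 2) → ℝ),
      (Measurable h₀ ∧
        (fieldMeasure (F.P P.K) (k + 1) (SU 2)).withDensity (fun V => (h₀ V : ℝ≥0∞)) = (fieldMeasure (F.P P.K) k (SU 2)).map (avOfRecord F 2 P.K k).avg ∧
        h₀ =ᵐ[fieldMeasure (F.P P.K) (k + 1) (SU 2)] avgDensity (avOfRecord F 2 P.K k).avg) ∧
      (∀ V', ρ' V' =
        (h₀ V' : ℝ) *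
          ∑ s' : SeqOfRecord F θ.ν θ.τ9.M (gOfRecord₁₃ F 2 θ P) P.K (k + 1),
            chiSeqOfRecord F 2 θ.ν θ.τ9.M (gOfRecord₁₃ F 2 θ P) P.K (k + 1) s' V' *
              ∫ U, wOfRecord₉ F 2 θ.toStage9Params P (gOfRecord₁₃ F 2 θ P) k s' U V' *
                  (chiSeqOfRecord F 2 θ.ν θ.τ9.M (gOfRecord₁₃ F 2 θ P) P.K k s'.init U *
                    slotsOfRecord F 2 θ.ν θ.τ9 (EOfRecord₁₃ F 2 θ) (wOfRecord₉ F 2 θ.toStage9Params) θ.ppSel P (gOfRecord₁₃ F 2 θ P) k s'.init U)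
                ∂(avgKernel (avOfRecord F 2 P.K k).avg V')) ∧
      ρ' =ᵐ[fieldMeasure (F.P P.K) (k + 1) (SU 2)] tdensOfRecord₁₃ F 2 θ P k ∧ ρ' V₁ = 0 := by
  obtain ⟨h₀, hm, hρ, hae, h0⟩ := exists_version_ae_eq_avgDensity_eq_zero F P.K k hk V₁
  refine ⟨h₀, fun V' => (h₀ V' : ℝ) * _, ⟨hm, hρ, hae⟩, fun V' => rfl, ?_, ?_⟩
  · have e : tdensOfRecord₁₃ F 2 θ P k = fun V' => (avgDensity (avOfRecord F 2 P.K k).avg V' : ℝ) *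
        ∑ s' : SeqOfRecord F θ.ν θ.τ9.M (gOfRecord₁₃ F 2 θ P) P.K (k + 1),
          chiSeqOfRecord F 2 θ.ν θ.τ9.M (gOfRecord₁₃ F 2 θ P) P.K (k + 1) s' V' *
            ∫ U, wOfRecord₉ F 2 θ.toStage9Params P (gOfRecord₁₃ F 2 θ P) k s' U V' *
                (chiSeqOfRecord F 2 θ.ν θ.τ9.M (gOfRecord₁₃ F 2 θ P) P.K k s'.init U *
                  slotsOfRecord F 2 θ.ν θ.τ9 (EOfRecord₁₃ F 2 θ) (wOfRecord₉ F 2 θ.toStage9Params) θ.ppSel P (gOfRecord₁₃ F 2 θ P) k s'.init U)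
              ∂(avgKernel (avOfRecord F 2 P.K k).avg V') :=
      funext fun V' => tdensOfRecord₁₃_eq_avgDensity_mul_sum θ P k V'
    rw [e]
    exact mul_ae_eq_mul_of_ae_eq hae _
  · show (h₀ V₁ : ℝ) * _ = 0
    rw [h0, NNReal.coe_zero, zero_mul]

end TImage

/-! ## §4 JUNCTION WITH p610399: the typed (2.50) ∕ K1⁷ PIN the value at `V₁`, while a `dV`-a.e.-equal version vanishes there -/

section Junction

variable (F : T4Family) (θ : Stage13HParams F 2) (h : θ.Provisos₁₃SepCoPH F 2)

/-- **★★★ (2.50) AT THE DATUM OF RECORD, AS TYPED, PINS `avgDensity … V₁ ≠ 0` (dag-n13-w1's `avgDensity_critCfg_one_ne_zero_of_cor3With_datum`, BY NAME) — AND the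
specification of that version is met by an `h₀ =ᵐ[dV]` it with `h₀ V₁ = 0`** (`V₁ := critCfgOfRecord θ.ν P.K (k+1) 1`, any windowed run, `k + 1 ≤ K`).  The pinned
inequality is thus a property of the CHOSEN witness, not of its a.e.-class.  LOCATED; K1⁷ neither proved nor refuted.
[cite: Balaban1988Convergent, Cor. 3 (2.50) p.264, (3.1) p.264; Balaban1989LargeFieldII, (0.1) pp.355–356; Balaban1987RG1, (0.4) p.253, (2.9) p.266 (bookkeeping)] -/
theorem pin_and_nonDetermination_of_cor3With_datum (hε' : 0 < θ.ε₂₉) {γ : ℝ} {em ep : ℝ → ℝ}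
    (hcor : B16.Cor3With (datumOfRecord₁₃SepCoPH F 2 θ h).C γ em ep) (P : B12.RunParams)
    (hP : ((datumOfRecord₁₃SepCoPH F 2 θ h).C P).flow.InInterval γ P.K) (k : ℕ) (hk : k + 1 ≤ P.K) :
    avgDensity (avOfRecord F 2 P.K k).avg (critCfgOfRecord F 2 θ.ν P.K (k + 1) 1) ≠ 0 ∧
      ∃ h₀ : GaugeField (F.P P.K) (k + 1) (SU 2) → ℝ≥0, Measurable h₀ ∧
        (fieldMeasure (F.P P.K) (k + 1) (SU 2)).withDensity (fun V => (h₀ V : ℝ≥0∞)) = (fieldMeasure (F.P P.K) k (SU 2)).map (avOfRecord F 2 P.K k).avg ∧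
        h₀ =ᵐ[fieldMeasure (F.P P.K) (k + 1) (SU 2)] avgDensity (avOfRecord F 2 P.K k).avg ∧ h₀ (critCfgOfRecord F 2 θ.ν P.K (k + 1) 1) = 0 :=
  ⟨avgDensity_critCfg_one_ne_zero_of_cor3With_datum θ h hε' hcor P hP k hk,
    exists_version_ae_eq_avgDensity_eq_zero F P.K k (Nat.lt_of_succ_le hk) _⟩

/-- **★★★ FROM THE CRUX DECL**: `StabilityBAtRecordR13SepCoPH` (K1⁷, stmt-QuantumFields-20542) gives, for every family with K0⁷'s conclusion, a `θ` and a windowed run `P` with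
`avgDensity (avOfRecord F 2 P.K 0).avg V₁ ≠ 0` at `V₁ := critCfgOfRecord θ.ν P.K 1 1` (dag-n13-w1's `exists_avgDensity_ne_zero_of_stabilityBAtRecordR13SepCoPH`, BY NAME) —
WHILE a version `h₀ =ᵐ[dV_1]` that version, with the same defining identity `dV_1.withDensity ↑h₀ = (dU_0).map Ū`, VANISHES at `V₁`.  An implication FROM the crux plus
kernel measure theory; K1⁷ is neither proved nor refuted here; READING in the module docstring.
[cite: Balaban1989LargeFieldII, Thm 1 p.355, (0.1) pp.355–356; Balaban1988Convergent, Cor. 3 (2.50) p.264; Balaban1987RG1, (0.4) p.253, (2.9) p.266 (bookkeeping)] -/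
theorem pin_and_nonDetermination_of_stabilityBAtRecordR13SepCoPH
    (hK1 : Summit.QuantumFields.YangMills.Theses.BalabanUVNodes.StabilityBAtRecordR13SepCoPH) (F : T4Family)
    (hK0 : ∃ θ : Stage13HParams F 2, θ.Provisos₁₃SepCoPH F 2 ∧ (θ.ZhUnity F 2 ∧ θ.SlotsNondegenerate₁₃ F 2) ∧ θ.Admissible F 2) :
    ∃ (θ : Stage13HParams F 2) (P : B12.RunParams), 1 ≤ P.K ∧
      avgDensity (avOfRecord F 2 P.K 0).avg (critCfgOfRecord F 2 θ.ν P.K 1 1) ≠ 0 ∧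
      ∃ h₀ : GaugeField (F.P P.K) 1 (SU 2) → ℝ≥0, Measurable h₀ ∧
        (fieldMeasure (F.P P.K) 1 (SU 2)).withDensity (fun V => (h₀ V : ℝ≥0∞)) = (fieldMeasure (F.P P.K) 0 (SU 2)).map (avOfRecord F 2 P.K 0).avg ∧
        h₀ =ᵐ[fieldMeasure (F.P P.K) 1 (SU 2)] avgDensity (avOfRecord F 2 P.K 0).avg ∧ h₀ (critCfgOfRecord F 2 θ.ν P.K 1 1) = 0 := by
  obtain ⟨θ, P, hK, hne⟩ := exists_avgDensity_ne_zero_of_stabilityBAtRecordR13SepCoPH hK1 F hK0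
  exact ⟨θ, P, hK, hne, exists_version_ae_eq_avgDensity_eq_zero F P.K 0 hK _⟩

/-- **★★★ THE SAME FROM THE rev-26∕27 DECIDING CRUX K1⁸ `StabilityBRunRowsAtRecordR13SepCoPH` (stmt-QuantumFields-26907)** — K1⁷ VERBATIM plus run rows at the same witness;
its (B) ∧ window conjuncts are K1⁷'s, so (dag-n13-w1's `exists_avgDensity_ne_zero_of_endStatementBPrinted_of_window`, BY NAME) it entails, for every family with K0⁷'s
conclusion, a `θ` and a windowed run `P` with `avgDensity (avOfRecord F 2 P.K 0).avg V₁ ≠ 0`, `V₁ := critCfgOfRecord θ.ν P.K 1 1` — WHILE a version `h₀ =ᵐ[dV_1]` that version,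
with the same defining identity, VANISHES at `V₁`.  An implication FROM the crux; K1⁸ is neither proved nor refuted here; READING in the module docstring.
[cite: Balaban1989LargeFieldII, Thm 1 p.355, (0.1) pp.355–356; Balaban1988Convergent, Cor. 3 (2.50) p.264; Balaban1987RG1, (0.4) p.253, (2.9) p.266, Thm 3 p.264 (bookkeeping)] -/
theorem pin_and_nonDetermination_of_stabilityBRunRowsAtRecordR13SepCoPH
    (hK1R : Summit.QuantumFields.YangMills.Theses.BalabanUVNodes.StabilityBRunRowsAtRecordR13SepCoPH) (F : T4Family)
    (hK0 : ∃ θ : Stage13HParams F 2, θ.Provisos₁₃SepCoPH F 2 ∧ (θ.ZhUnity F 2 ∧ θ.SlotsNondegenerate₁₃ F 2) ∧ θ.Admissible F 2) :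
    ∃ (θ : Stage13HParams F 2) (P : B12.RunParams), 1 ≤ P.K ∧
      avgDensity (avOfRecord F 2 P.K 0).avg (critCfgOfRecord F 2 θ.ν P.K 1 1) ≠ 0 ∧
      ∃ h₀ : GaugeField (F.P P.K) 1 (SU 2) → ℝ≥0, Measurable h₀ ∧
        (fieldMeasure (F.P P.K) 1 (SU 2)).withDensity (fun V => (h₀ V : ℝ≥0∞)) = (fieldMeasure (F.P P.K) 0 (SU 2)).map (avOfRecord F 2 P.K 0).avg ∧
        h₀ =ᵐ[fieldMeasure (F.P P.K) 1 (SU 2)] avgDensity (avOfRecord F 2 P.K 0).avg ∧ h₀ (critCfgOfRecord F 2 θ.ν P.K 1 1) = 0 := by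
  obtain ⟨θ, h, -, hθ, hB, hW, -⟩ := hK1R F hK0
  obtain ⟨P, hK, hne⟩ := exists_avgDensity_ne_zero_of_endStatementBPrinted_of_window θ h hθ.ε₂₉_pos hB hW
  exact ⟨θ, P, hK, hne, exists_version_ae_eq_avgDensity_eq_zero F P.K 0 hK _⟩

end Junction

end Summit.QuantumFields.YangMills.BalabanUVNodes.N13Cor3MargDensityVersionNotDeterminedAtRecord13

end
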